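import Literature.NumberTheory.EllipticCurves.GrossPointsPicardAction
import Literature.NumberTheory.Automorphic.BrandtModuleDictionary
import HarnessLib

/-!
# `Pic(𝒪_c)` preserves the Gross points of conductor `c` (BD96 §2.3: "well-defined")

Theorems only (no definition, no named fact). Bertolini–Darmon, Invent. Math. 126 (1996), §2.3
assert that the rule `σ (g × f) = (g f̂(σ) × f)` is a well-defined action of `Pic(𝒪)` on the set
`H_N(K; c)` of Heegner points of conductor `c` ("The reader will check that this action is
well-defined and free"). In the ideal-theoretic model of `GrossPoints.lean` /
`GrossPointsPicardAction.lean` this is the statement that for a Heegner representative `(f, I)`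
of conductor `c` (an invertible right `O`-ideal `I` and an optimal embedding `f` of `𝒪_c` into
`O_L(I)`) and an invertible fractional `𝒪_c`-ideal `𝔞`, the pair `(f, f(𝔞) I)` is again a Heegner
representative of conductor `c`. We prove it (write `A = f(𝔞)`, `A' = f(𝔞⁻¹)`, `O' = f(𝒪_c)`,
`L = O_L(I)`; the inputs are `A A' = A' A = O'`, `O' I = I`, `O' ⊆ L` and commutativity of `K`):

* `GrossRep.leftOrder_embLattice_mul`: **`O_L(A I) = A L A'`**;
* `GrossRep.rightOrder_embLattice_mul`: `O_R(A I) = O_R(I)`;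
* `GrossRep.apply_mem_leftOrder_embLattice_mul_iff`: `f x ∈ O_L(A I) ↔ f x ∈ O_L(I)` (so `f`
  stays optimal of conductor `c`);
* `GrossRep.isFullLattice_embLattice_mul`: `A I` is a full lattice (`f(a) I ⊆ A I ⊆ f(a')⁻¹ I` for
  nonzero `a ∈ 𝔞`, `a' ∈ 𝔞⁻¹`);
* `GrossRep.IsHeegner.fracIdeal_mul`: `(f, A I)` is a Heegner representative of conductor `c`
  (invertibility with the inverse `I' A'`);
* `picard_smul_mem_grossPoints`: **`σ • x ∈ grossPoints K S c` for `x ∈ grossPoints K S c` and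
  `σ ∈ Pic(𝒪_c)`** — `Pic(𝒪_c)` acts on `H(K, c)` (BD96 §2.3) through the lawful group action
  `GrossSpace.picardMulAction`.

Freeness and the orbit count (BD96 Lemma 2.5) are not treated.

## References

* [BertoliniDarmon1996] §2.3 (4).
* [Voight2021] §16.5–16.6 (invertible lattices, compatible products).
-/

noncomputable section

open scoped Pointwise nonZeroDivisors
open NumberField Literature.NumberTheory.Automorphic

universe u v

namespace Literature.NumberTheory.EllipticCurves

variable {D : Type v} [Ring D] [Algebra ℚ D] {K : Type u} [Field K] [NumberField K]

/-! ### Submodule-product toolkit -/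

section Toolkit

variable {B : Type v} [Ring B]

/-- `X ⊆ O_L(Y) ↔ X Y ⊆ Y`. [folklore] -/
theorem le_leftOrder_iff_mul_le {X Y : Submodule ℤ B} : X ≤ Brandt.leftOrder Y ↔ X * Y ≤ Y := by
  rw [Submodule.mul_le]
  exact ⟨fun h x hx y hy => h hx y hy, fun h x hx y hy => h x hx y hy⟩

/-- `X ⊆ O_R(Y) ↔ Y X ⊆ Y`. [folklore] -/
theorem le_rightOrder_iff_mul_le {X Y : Submodule ℤ B} : X ≤ Brandt.rightOrder Y ↔ Y * X ≤ Y := by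
  rw [Submodule.mul_le]
  exact ⟨fun h y hy x hx => h hx y hy, fun h x hx y hy => h y hy x hx⟩

/-- `y ∈ O_L(Y) ↔ (ℤ y) Y ⊆ Y`. [folklore] -/
theorem mem_leftOrder_iff_span_mul_le {Y : Submodule ℤ B} {y : B} :
    y ∈ Brandt.leftOrder Y ↔ (ℤ ∙ y) * Y ≤ Y := by
  rw [← le_leftOrder_iff_mul_le, Submodule.span_singleton_le_iff_mem]

/-- `y ∈ O_R(Y) ↔ Y (ℤ y) ⊆ Y`. [folklore] -/
theorem mem_rightOrder_iff_mul_span_le {Y : Submodule ℤ B} {y : B} :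
    y ∈ Brandt.rightOrder Y ↔ Y * (ℤ ∙ y) ≤ Y := by
  rw [← le_rightOrder_iff_mul_le, Submodule.span_singleton_le_iff_mem]

/-- `O_L(Y) O_L(Y) ⊆ O_L(Y)`. [folklore] -/
theorem leftOrder_mul_leftOrder_le (Y : Submodule ℤ B) :
    Brandt.leftOrder Y * Brandt.leftOrder Y ≤ Brandt.leftOrder Y :=
  Submodule.mul_le.mpr fun _ ha _ hb => Brandt.mul_mem_leftOrder ha hb

end Toolkit

namespace GrossRep

variable (f : K →ₐ[ℚ] D)

/-- Images of lattices of `K` commute: `f(𝔞) f(𝔟) = f(𝔟) f(𝔞)` (`K` is commutative). [folklore] -/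
theorem embLattice_mul_comm (𝔞 𝔟 : Submodule ℤ K) :
    embLattice f 𝔞 * embLattice f 𝔟 = embLattice f 𝔟 * embLattice f 𝔞 := by
  rw [← embLattice_mul, mul_comm, embLattice_mul]

/-- `f(ℤ x) = ℤ f(x)`. [folklore] -/
theorem embLattice_span_singleton (x : K) : embLattice f (ℤ ∙ x) = ℤ ∙ f x := by
  rw [embLattice, Submodule.map_span, Set.image_singleton]
  rfl

/-- `ℤ f(x)` commutes with every `f(𝔟)`. [folklore] -/
theorem span_singleton_mul_embLattice_comm (x : K) (𝔟 : Submodule ℤ K) :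
    (ℤ ∙ f x) * embLattice f 𝔟 = embLattice f 𝔟 * (ℤ ∙ f x) := by
  rw [← embLattice_span_singleton, embLattice_mul_comm]

/-- `1 ∈ f(𝒪_c)`. [folklore] -/
theorem one_mem_embLattice_quadOrder (c : ℕ) :
    (1 : D) ∈ embLattice f (Subalgebra.toSubmodule (quadOrder K c)) := by
  have h : f 1 ∈ embLattice f (Subalgebra.toSubmodule (quadOrder K c)) :=
    apply_mem_embLattice f (Subalgebra.one_mem (quadOrder K c))
  simpa using h

variable {f}

section FracIdeal

variable {c : ℕ} (𝔞 : (FractionalIdeal (quadOrder K c)⁰ K)ˣ)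

/-- `f(𝔞) f(𝔞⁻¹) = f(𝒪_c)`. [folklore] -/
theorem embLattice_fracIdeal_mul_inv :
    embLattice f (fracIdealLattice c (𝔞 : FractionalIdeal _ K)) *
      embLattice f (fracIdealLattice c ((𝔞⁻¹ : (FractionalIdeal (quadOrder K c)⁰ K)ˣ) :
        FractionalIdeal _ K)) =
      embLattice f (Subalgebra.toSubmodule (quadOrder K c)) := by
  rw [← embLattice_mul, ← fracIdealLattice_mul, Units.mul_inv, fracIdealLattice_one]

/-- `f(𝔞⁻¹) f(𝔞) = f(𝒪_c)`. [folklore] -/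
theorem embLattice_fracIdeal_inv_mul :
    embLattice f (fracIdealLattice c ((𝔞⁻¹ : (FractionalIdeal (quadOrder K c)⁰ K)ˣ) :
        FractionalIdeal _ K)) *
      embLattice f (fracIdealLattice c (𝔞 : FractionalIdeal _ K)) =
      embLattice f (Subalgebra.toSubmodule (quadOrder K c)) := by
  rw [← embLattice_mul, ← fracIdealLattice_mul, Units.inv_mul, fracIdealLattice_one]

end FracIdeal

variable {c : ℕ} {r : GrossRep D K}

/-- `f(𝒪_c) ⊆ O_L(I)` gives `f(𝒪_c) I = I`. [folklore] -/
theorem embLattice_quadOrder_mul_eq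
    (h : ∀ x : K, x ∈ quadOrder K c → r.emb x ∈ Brandt.leftOrder r.lat) :
    embLattice r.emb (Subalgebra.toSubmodule (quadOrder K c)) * r.lat = r.lat := by
  refine le_antisymm ?_ fun m hm => ?_
  · rw [Submodule.mul_le]
    rintro _ ⟨a, ha, rfl⟩ m hm
    exact h a ha m hm
  · simpa using Submodule.mul_mem_mul (one_mem_embLattice_quadOrder r.emb c) hm

/-- `f(𝒪_c) ⊆ O_L(I)`, as lattices. [folklore] -/
theorem embLattice_quadOrder_le_leftOrder
    (h : ∀ x : K, x ∈ quadOrder K c → r.emb x ∈ Brandt.leftOrder r.lat) :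
    embLattice r.emb (Subalgebra.toSubmodule (quadOrder K c)) ≤ Brandt.leftOrder r.lat := by
  rintro _ ⟨a, ha, rfl⟩; exact h a ha

variable (𝔞 : (FractionalIdeal (quadOrder K c)⁰ K)ˣ)

/-- **`O_L(f(𝔞) I) = f(𝔞) O_L(I) f(𝔞⁻¹)`** for a pair `(f, I)` with `f(𝒪_c) ⊆ O_L(I)` and an
invertible fractional `𝒪_c`-ideal `𝔞`. (`⊇`: `(A L A')(A I) = A L (A'A) I = A L I = A I`; `⊆`: if
`y A I ⊆ A I` then `A' y A I ⊆ I`, so `A' y A ⊆ L` and `y ∈ (A A') y (A A') ⊆ A L A'`.) [folklore] -/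
theorem leftOrder_embLattice_mul
    (h : ∀ x : K, x ∈ quadOrder K c → r.emb x ∈ Brandt.leftOrder r.lat) :
    Brandt.leftOrder (embLattice r.emb (fracIdealLattice c (𝔞 : FractionalIdeal _ K)) * r.lat) =
      embLattice r.emb (fracIdealLattice c (𝔞 : FractionalIdeal _ K)) * Brandt.leftOrder r.lat *
        embLattice r.emb (fracIdealLattice c ((𝔞⁻¹ : (FractionalIdeal (quadOrder K c)⁰ K)ˣ) :
          FractionalIdeal _ K)) := by
  have hAA' := embLattice_fracIdeal_mul_inv (f := r.emb) 𝔞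
  have hA'A := embLattice_fracIdeal_inv_mul (f := r.emb) 𝔞
  have hO'I := embLattice_quadOrder_mul_eq h
  have h1O' := one_mem_embLattice_quadOrder r.emb c
  apply le_antisymm
  · intro y hy
    have hy' := mem_leftOrder_iff_span_mul_le.mp hy
    -- `A' (ℤ y) A ⊆ L`
    have hZ : embLattice r.emb (fracIdealLattice c ((𝔞⁻¹ : (FractionalIdeal (quadOrder K c)⁰ K)ˣ) :
          FractionalIdeal _ K)) * (ℤ ∙ y) *
        embLattice r.emb (fracIdealLattice c (𝔞 : FractionalIdeal _ K)) ≤ Brandt.leftOrder r.lat := by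
      rw [le_leftOrder_iff_mul_le]
      calc _ = embLattice r.emb (fracIdealLattice c ((𝔞⁻¹ : (FractionalIdeal (quadOrder K c)⁰ K)ˣ) :
              FractionalIdeal _ K)) * ((ℤ ∙ y) *
              (embLattice r.emb (fracIdealLattice c (𝔞 : FractionalIdeal _ K)) * r.lat)) := by
            simp only [mul_assoc]
        _ ≤ embLattice r.emb (fracIdealLattice c ((𝔞⁻¹ : (FractionalIdeal (quadOrder K c)⁰ K)ˣ) :
              FractionalIdeal _ K)) *
              (embLattice r.emb (fracIdealLattice c (𝔞 : FractionalIdeal _ K)) * r.lat) :=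
            mul_le_mul_right hy' _
        _ = r.lat := by rw [← mul_assoc, hA'A, hO'I]
    -- `y ∈ O' (ℤ y) O' = A (A' (ℤ y) A) A' ⊆ A L A'`
    have hy1 : y ∈ embLattice r.emb (Subalgebra.toSubmodule (quadOrder K c)) * (ℤ ∙ y) *
        embLattice r.emb (Subalgebra.toSubmodule (quadOrder K c)) := by
      have : (ℤ ∙ y) ≤ embLattice r.emb (Subalgebra.toSubmodule (quadOrder K c)) * (ℤ ∙ y) *
          embLattice r.emb (Subalgebra.toSubmodule (quadOrder K c)) :=
        calc (ℤ ∙ y) = 1 * (ℤ ∙ y) * 1 := by rw [one_mul, mul_one]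
          _ ≤ _ := mul_le_mul' (mul_le_mul' (Submodule.one_le.mpr h1O') le_rfl)
              (Submodule.one_le.mpr h1O')
      exact this (Submodule.mem_span_singleton_self y)
    rw [← hAA'] at hy1
    have : embLattice r.emb (fracIdealLattice c (𝔞 : FractionalIdeal _ K)) *
        embLattice r.emb (fracIdealLattice c ((𝔞⁻¹ : (FractionalIdeal (quadOrder K c)⁰ K)ˣ) :
          FractionalIdeal _ K)) * (ℤ ∙ y) *
        (embLattice r.emb (fracIdealLattice c (𝔞 : FractionalIdeal _ K)) *
          embLattice r.emb (fracIdealLattice c ((𝔞⁻¹ : (FractionalIdeal (quadOrder K c)⁰ K)ˣ) :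
            FractionalIdeal _ K))) ≤ _ :=
      calc _ = embLattice r.emb (fracIdealLattice c (𝔞 : FractionalIdeal _ K)) *
            (embLattice r.emb (fracIdealLattice c ((𝔞⁻¹ : (FractionalIdeal (quadOrder K c)⁰ K)ˣ) :
              FractionalIdeal _ K)) * (ℤ ∙ y) *
              embLattice r.emb (fracIdealLattice c (𝔞 : FractionalIdeal _ K))) *
            embLattice r.emb (fracIdealLattice c ((𝔞⁻¹ : (FractionalIdeal (quadOrder K c)⁰ K)ˣ) :
              FractionalIdeal _ K)) := by simp only [mul_assoc]
        _ ≤ embLattice r.emb (fracIdealLattice c (𝔞 : FractionalIdeal _ K)) * Brandt.leftOrder r.lat *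
            embLattice r.emb (fracIdealLattice c ((𝔞⁻¹ : (FractionalIdeal (quadOrder K c)⁰ K)ˣ) :
              FractionalIdeal _ K)) := mul_le_mul' (mul_le_mul_right hZ _) le_rfl
    exact this hy1
  · rw [le_leftOrder_iff_mul_le]
    calc _ = embLattice r.emb (fracIdealLattice c (𝔞 : FractionalIdeal _ K)) * (Brandt.leftOrder r.lat *
          ((embLattice r.emb (fracIdealLattice c ((𝔞⁻¹ : (FractionalIdeal (quadOrder K c)⁰ K)ˣ) :
            FractionalIdeal _ K)) * embLattice r.emb (fracIdealLattice c (𝔞 : FractionalIdeal _ K))) *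
            r.lat)) := by simp only [mul_assoc]
      _ = embLattice r.emb (fracIdealLattice c (𝔞 : FractionalIdeal _ K)) * r.lat := by
          rw [hA'A, hO'I, Brandt.leftOrder_mul_self]
      _ ≤ _ := le_rfl

/-- **`O_R(f(𝔞) I) = O_R(I)`** under the same hypotheses. [folklore] -/
theorem rightOrder_embLattice_mul
    (h : ∀ x : K, x ∈ quadOrder K c → r.emb x ∈ Brandt.leftOrder r.lat) :
    Brandt.rightOrder (embLattice r.emb (fracIdealLattice c (𝔞 : FractionalIdeal _ K)) * r.lat) =
      Brandt.rightOrder r.lat := by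
  refine le_antisymm (fun y hy => ?_) (Brandt.rightOrder_le_rightOrder_mul _ _)
  rw [mem_rightOrder_iff_mul_span_le] at hy ⊢
  have key := mul_le_mul_right hy
    (embLattice r.emb (fracIdealLattice c ((𝔞⁻¹ : (FractionalIdeal (quadOrder K c)⁰ K)ˣ) :
      FractionalIdeal _ K)))
  simp only [← mul_assoc, embLattice_fracIdeal_inv_mul, embLattice_quadOrder_mul_eq h] at key
  exact key

/-- **Optimality is preserved**: `f x ∈ O_L(f(𝔞) I) ↔ f x ∈ O_L(I)` (so `f` is an optimal
embedding of `𝒪_c` into `O_L(f(𝔞) I)` iff it is one into `O_L(I)`). (`←`: `f x ∈ O' ⊆ A L A'`;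
`→`: `(ℤ f x) O' = A' (ℤ f x) A ⊆ O' L O' ⊆ L` by commutativity.) [folklore] -/
theorem apply_mem_leftOrder_embLattice_mul_iff
    (h : ∀ x : K, x ∈ quadOrder K c → r.emb x ∈ Brandt.leftOrder r.lat) (x : K) :
    r.emb x ∈ Brandt.leftOrder (embLattice r.emb (fracIdealLattice c (𝔞 : FractionalIdeal _ K)) * r.lat) ↔
      r.emb x ∈ Brandt.leftOrder r.lat := by
  have hA'A := embLattice_fracIdeal_inv_mul (f := r.emb) 𝔞
  have hAA' := embLattice_fracIdeal_mul_inv (f := r.emb) 𝔞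
  have hO'L := embLattice_quadOrder_le_leftOrder h
  have h1O' := one_mem_embLattice_quadOrder r.emb c
  rw [leftOrder_embLattice_mul 𝔞 h]
  constructor
  · intro hx
    have hx' : (ℤ ∙ r.emb x) ≤ _ := (Submodule.span_singleton_le_iff_mem _ _).mpr hx
    have e1 : embLattice r.emb (fracIdealLattice c ((𝔞⁻¹ : (FractionalIdeal (quadOrder K c)⁰ K)ˣ) :
          FractionalIdeal _ K)) * (ℤ ∙ r.emb x) *
        embLattice r.emb (fracIdealLattice c (𝔞 : FractionalIdeal _ K)) =
        (ℤ ∙ r.emb x) * embLattice r.emb (Subalgebra.toSubmodule (quadOrder K c)) := by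
      rw [mul_assoc, span_singleton_mul_embLattice_comm, ← mul_assoc, hA'A,
        ← span_singleton_mul_embLattice_comm]
    have hZ : (ℤ ∙ r.emb x) * embLattice r.emb (Subalgebra.toSubmodule (quadOrder K c)) ≤
        Brandt.leftOrder r.lat :=
      calc _ = _ := e1.symm
        _ ≤ embLattice r.emb (fracIdealLattice c ((𝔞⁻¹ : (FractionalIdeal (quadOrder K c)⁰ K)ˣ) :
              FractionalIdeal _ K)) *
            (embLattice r.emb (fracIdealLattice c (𝔞 : FractionalIdeal _ K)) * Brandt.leftOrder r.lat *
              embLattice r.emb (fracIdealLattice c ((𝔞⁻¹ : (FractionalIdeal (quadOrder K c)⁰ K)ˣ) :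
                FractionalIdeal _ K))) *
            embLattice r.emb (fracIdealLattice c (𝔞 : FractionalIdeal _ K)) :=
          mul_le_mul' (mul_le_mul_right hx' _) le_rfl
        _ = embLattice r.emb (Subalgebra.toSubmodule (quadOrder K c)) * Brandt.leftOrder r.lat *
            embLattice r.emb (Subalgebra.toSubmodule (quadOrder K c)) := by
          rw [show ∀ A A' L : Submodule ℤ D, A' * (A * L * A') * A = (A' * A) * L * (A' * A) from
            fun _ _ _ => by simp only [mul_assoc], hA'A]
        _ ≤ Brandt.leftOrder r.lat * Brandt.leftOrder r.lat * Brandt.leftOrder r.lat :=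
          mul_le_mul' (mul_le_mul' hO'L le_rfl) hO'L
        _ ≤ Brandt.leftOrder r.lat :=
          (mul_le_mul_left (leftOrder_mul_leftOrder_le _) _).trans (leftOrder_mul_leftOrder_le _)
    exact hZ (by simpa using Submodule.mul_mem_mul (Submodule.mem_span_singleton_self (r.emb x)) h1O')
  · intro hx
    have hx' : (ℤ ∙ r.emb x) ≤ Brandt.leftOrder r.lat :=
      (Submodule.span_singleton_le_iff_mem _ _).mpr hx
    have : (ℤ ∙ r.emb x) * embLattice r.emb (Subalgebra.toSubmodule (quadOrder K c)) ≤
        embLattice r.emb (fracIdealLattice c (𝔞 : FractionalIdeal _ K)) * Brandt.leftOrder r.lat *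
          embLattice r.emb (fracIdealLattice c ((𝔞⁻¹ : (FractionalIdeal (quadOrder K c)⁰ K)ˣ) :
            FractionalIdeal _ K)) :=
      calc _ = (ℤ ∙ r.emb x) * (embLattice r.emb (fracIdealLattice c (𝔞 : FractionalIdeal _ K)) *
            embLattice r.emb (fracIdealLattice c ((𝔞⁻¹ : (FractionalIdeal (quadOrder K c)⁰ K)ˣ) :
              FractionalIdeal _ K))) := by rw [hAA']
        _ = embLattice r.emb (fracIdealLattice c (𝔞 : FractionalIdeal _ K)) * (ℤ ∙ r.emb x) *
            embLattice r.emb (fracIdealLattice c ((𝔞⁻¹ : (FractionalIdeal (quadOrder K c)⁰ K)ˣ) :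
              FractionalIdeal _ K)) := by
          rw [← mul_assoc, span_singleton_mul_embLattice_comm]
        _ ≤ _ := mul_le_mul' (mul_le_mul_right hx' _) le_rfl
    exact this (by simpa using Submodule.mul_mem_mul (Submodule.mem_span_singleton_self (r.emb x)) h1O')

/-- **`f(𝔞) I` is a full lattice** when `I` is one, `f(𝒪_c) ⊆ O_L(I)` and `𝔞` is an invertible
fractional `𝒪_c`-ideal: `f(a) I ⊆ f(𝔞) I ⊆ f(a')⁻¹ I` for nonzero `a ∈ 𝔞 ∩ 𝒪_c`,
`a' ∈ 𝔞⁻¹ ∩ 𝒪_c`, and unit translates of full lattices are full. [folklore] -/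
theorem isFullLattice_embLattice_mul [NeZero c] (hfull : IsFullLattice D r.lat)
    (h : ∀ x : K, x ∈ quadOrder K c → r.emb x ∈ Brandt.leftOrder r.lat) :
    IsFullLattice D (embLattice r.emb (fracIdealLattice c (𝔞 : FractionalIdeal _ K)) * r.lat) := by
  have hA'A := embLattice_fracIdeal_inv_mul (f := r.emb) 𝔞
  have hO'I := embLattice_quadOrder_mul_eq h
  obtain ⟨a, ha0, ha⟩ := FractionalIdeal.exists_ne_zero_mem_isInteger (Units.ne_zero 𝔞)
  obtain ⟨a', ha0', ha'⟩ := FractionalIdeal.exists_ne_zero_mem_isInteger (Units.ne_zero 𝔞⁻¹)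
  have haK : algebraMap (quadOrder K c) K a ≠ 0 := by
    rwa [Ne, FaithfulSMul.algebraMap_eq_zero_iff]
  have haK' : algebraMap (quadOrder K c) K a' ≠ 0 := by
    rwa [Ne, FaithfulSMul.algebraMap_eq_zero_iff]
  let ua : Dˣ := GrossSpace.embUnit r.emb (Units.mk0 _ haK)
  let ua' : Dˣ := GrossSpace.embUnit r.emb (Units.mk0 _ haK')
  have hfg : (ua'⁻¹ • r.lat).FG := (Brandt.isFullLattice_units_smul hfull ua'⁻¹).1
  refine ⟨Submodule.FG.of_le hfg ?_, fun d => ?_⟩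
  · -- `A I ≤ f(a')⁻¹ I` since `f(a') (A I) ⊆ A' A I = O' I = I`
    intro m hm
    rw [mem_units_smul_submodule_iff, inv_inv, Units.smul_def]
    have hle : (ℤ ∙ r.emb (algebraMap (quadOrder K c) K a')) *
        (embLattice r.emb (fracIdealLattice c (𝔞 : FractionalIdeal _ K)) * r.lat) ≤ r.lat :=
      calc _ ≤ embLattice r.emb (fracIdealLattice c ((𝔞⁻¹ : (FractionalIdeal (quadOrder K c)⁰ K)ˣ) :
              FractionalIdeal _ K)) *
            (embLattice r.emb (fracIdealLattice c (𝔞 : FractionalIdeal _ K)) * r.lat) :=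
          mul_le_mul_left ((Submodule.span_singleton_le_iff_mem _ _).mpr
            (apply_mem_embLattice r.emb ha')) _
        _ = r.lat := by rw [← mul_assoc, hA'A, hO'I]
    exact hle (Submodule.mul_mem_mul (Submodule.mem_span_singleton_self _) hm)
  · -- `f(a) I ⊆ A I` and `f(a) I` is full
    obtain ⟨n, hn, hnd⟩ := (Brandt.isFullLattice_units_smul hfull ua).2 d
    refine ⟨n, hn, ?_⟩
    have hle : ua • r.lat ≤ embLattice r.emb (fracIdealLattice c (𝔞 : FractionalIdeal _ K)) * r.lat := by
      rw [Units.smul_def, ← Submodule.span_singleton_mul]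
      exact mul_le_mul_left ((Submodule.span_singleton_le_iff_mem _ _).mpr
        (apply_mem_embLattice r.emb ha)) _
    exact hle hnd

/-- **The action of an invertible `𝒪_c`-ideal preserves Heegner representatives of conductor
`c`** (BD96 §2.3: the action (4) on `H_N(K; c)` "is well-defined"): for a Brandt setup `S`, a
Heegner representative `(f, I)` of conductor `c` and an invertible fractional `𝒪_c`-ideal `𝔞`,
`(f, f(𝔞) I)` is a Heegner representative of conductor `c`. [cite: BertoliniDarmon1996, §2.3 (4)] -/
theorem IsHeegner.fracIdeal_mul {Nplus Nminus : ℕ} (S : Brandt.XiSetup Nplus Nminus)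
    [NeZero c] (𝔞 : (FractionalIdeal (quadOrder K c)⁰ K)ˣ) {r : GrossRep S.D K}
    (hr : r.IsHeegner S.O c) :
    (⟨r.emb, embLattice r.emb (fracIdealLattice c (𝔞 : FractionalIdeal _ K)) * r.lat⟩ :
      GrossRep S.D K).IsHeegner S.O c := by
  have hO : IsZOrder S.O := isZOrder_iff_isOrder.mpr S.isEichlerOrder.isOrder
  have hopt : ∀ x : K, x ∈ quadOrder K c → r.emb x ∈ Brandt.leftOrder r.lat :=
    fun x hx => (hr.2 x).mpr hx
  have hA'A := embLattice_fracIdeal_inv_mul (f := r.emb) 𝔞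
  have hO'I := embLattice_quadOrder_mul_eq hopt
  have hI : IsInvertibleRightIdeal S.O r.lat := by
    have := hr.1
    rwa [rightIdeals_eq_invertibleRightIdeals_of_isTotallyDefinite S.isTotallyDefinite hO] at this
  refine ⟨?_, fun x => (apply_mem_leftOrder_embLattice_mul_iff 𝔞 hopt x).trans (hr.2 x)⟩
  change embLattice r.emb (fracIdealLattice c (𝔞 : FractionalIdeal _ K)) * r.lat ∈ _
  rw [rightIdeals_eq_invertibleRightIdeals_of_isTotallyDefinite S.isTotallyDefinite hO]
  refine ⟨isFullLattice_embLattice_mul 𝔞 hI.isFullLattice hopt, ?_, ?_⟩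
  · exact (rightOrder_embLattice_mul 𝔞 hopt).trans hI.rightOrderOf_eq
  · obtain ⟨I', h1, h2⟩ := hI.exists_inv
    refine ⟨I' * embLattice r.emb (fracIdealLattice c ((𝔞⁻¹ : (FractionalIdeal (quadOrder K c)⁰ K)ˣ) :
      FractionalIdeal _ K)), ?_, ?_⟩
    · change _ = Brandt.leftOrder _
      rw [leftOrder_embLattice_mul 𝔞 hopt]
      change _ = _ * leftOrderOf r.lat * _
      rw [← h1]
      simp only [mul_assoc]
    · calc _ = I' * ((embLattice r.emb (fracIdealLattice c ((𝔞⁻¹ : (FractionalIdeal (quadOrder K c)⁰ K)ˣ) :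
              FractionalIdeal _ K)) * embLattice r.emb (fracIdealLattice c (𝔞 : FractionalIdeal _ K))) *
            r.lat) := by simp only [mul_assoc]
        _ = S.O := by rw [hA'A, hO'I, h2]

end GrossRep

/-- **`Pic(𝒪_c)` acts on the Gross points of conductor `c`** (BD96 §2.3): for
`x ∈ grossPoints K S c` and `σ ∈ Pic(𝒪_c) = ClassGroup (quadOrder K c)`, `σ • x ∈ grossPoints K S c`.
[cite: BertoliniDarmon1996, §2.3 (4)] -/
theorem picard_smul_mem_grossPoints {Nplus Nminus : ℕ} {S : Brandt.XiSetup Nplus Nminus} {c : ℕ}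
    [NeZero c] {x : GrossSpace S.D K} (hx : x ∈ grossPoints K S c)
    (σ : ClassGroup (quadOrder K c)) : σ • x ∈ grossPoints K S c := by
  have hsat := GrossSpace.isSaturated_of_mem_grossPoints hx
  obtain ⟨r, rfl, hr⟩ := hx
  refine ClassGroup.induction (K := K) (fun 𝔞 => ?_) σ
  rw [GrossSpace.picard_mk_smul_mk c 𝔞 r hsat, mk_mem_grossPoints_iff]
  exact hr.fracIdeal_mul S 𝔞

/-- Hence the whole orbit of a Gross point of conductor `c` consists of Gross points of
conductor `c`, and in particular their lattices are invertible right `O`-ideals (no junk in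
`yValue`). [folklore] -/
theorem picard_smul_mem_grossPoints_iff {Nplus Nminus : ℕ} {S : Brandt.XiSetup Nplus Nminus}
    {c : ℕ} [NeZero c] {x : GrossSpace S.D K} (σ : ClassGroup (quadOrder K c)) :
    σ • x ∈ grossPoints K S c ↔ x ∈ grossPoints K S c := by
  refine ⟨fun h => ?_, fun h => picard_smul_mem_grossPoints h σ⟩
  have := picard_smul_mem_grossPoints h σ⁻¹
  rwa [inv_smul_smul] at this

end Literature.NumberTheory.EllipticCurves

end
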